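import Summits.KontsevichZagierPeriods.KontsevichZagierPeriods.Theses.SymplecticScissors
import Summits.KontsevichZagierPeriods.KontsevichZagierPeriods.Theorems.UnfoldedStokesStokesGenerationLineReductionNamed
import Summits.KontsevichZagierPeriods.KontsevichZagierPeriods.Theorems.LiftingCriteriaCubeNashNormalFormDimLeOne

/-!
# Crux `VolumeFormOffPlane` (stmt-KontsevichZagierPeriods-14935) — line `arithmetic-resolution`
# (crux strategist, gen 1): ARITHMETIC INPUT × RESOLUTION CHARTS × CHART COMPILER

The crux (the frame off the plane) is summit-equivalent verbatim
(`Theorems/VolumeFormOffPlane/Negative/Core.lean`). This skeleton concludes it BY NAME from three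
registered stubs of three different natures, through the strategist's decomposition
`VolumeFormOffPlane ⟸ TypeAGeneration (stmt-18392) ∧ CubeNashNormalForm (stmt-3574)`
(glue `OffPlaneSplitGlue`, stmt-18438, re-proved inline below since the glue file is not yet landed):

* `stub_typeAGeneration` — **(T) the arithmetic input**: the route item `TypeAGeneration`
  (stmt-18392) by name = Ayoub 2015 Conj. 1.1 / Fresán 2024 Conj. 3.5 verbatim (= the tree leaf
  `TypeAGenerationConjecture`). OPEN (GPC-strength). Values of cube integrals only.
* `stub_localUniformization` — **(LU) resolution charts, pure real-analytic geometry, no moves, no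
  values**: every bounded `ℚ`-semialgebraic solid `S ⊆ ℝ^{m+3}` is, off a Lebesgue-null set, the
  disjoint union of finitely many images of the OPEN unit cube under `ℚ`-semialgebraic maps that are
  real-analytic on a neighbourhood of the CLOSED cube, injective on the open cube, with Jacobian
  determinant `≥ 0` on the closed cube (embedded resolution of `∂S` over `ℝ` / rectilinearization:
  Hironaka 1964, Bierstone–Milman 1988 §4, read chart by chart; orientation fixed by a reflection,
  possible because an injective map has constant local degree). OPEN in the tree (XL); the genuinely
  geometric core of item 3574 (`cubeNashNormalForm_of_volume_three` isolates exactly dimension `≥ 3`).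
* `stub_chartsToNormalForm` — **(C) the chart compiler, provable now (M–L)**: given such charts for
  `K.domain`, `[K] ≡ Σⱼ [□̄, det DΦⱼ]` inside the moves — domain additivity over the disjoint a.e.
  cover (null remainder and null cube boundary are relations) and ONE change-of-variables move per
  chart (`KZ.changeOfVariablesRel` with `Φ' = fderiv`, integrand `|det| = det`), the Jacobian being
  `ℚ`-semialgebraic and real-analytic near the closed cube — i.e. exactly the hypothesis of
  `LiftingCriteria.CubeNashNormalFormReduction.cubeNashNormalForm_of_volume_three` for this `K`.

Composition (sorry-free): (LU) + (C) ⇒ the hypothesis of `cubeNashNormalForm_of_volume_three` ⇒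
`CubeNashNormalForm` (3574; plane = Newton–Puiseux and line/point are LANDED there) ⇒ with (T), by
the landed Ayoub compiler `sum_cubeNash_mem_relations_of_typeAGenerationConjecture` (normal form →
soundness → compiler → telescope), the frame in every dimension ⇒ the crux by name.

Disproof used: `Disproof.lean` §1 (the crux is the summit: no stub below is weaker-looking costume of
it — (T) is arithmetic in another algebra, (LU) has no values and no moves, (C) is a compiler);
§2a (`value_eq` load-bearing: it enters only through soundness in the glue); §4 (cuts are necessary:
(C) uses domain additivity essentially); §5 (Dehn form: a refutation must be an additive invariant —
it would have to see either a non-Stokes coincidence of cube integrals (¬T) or a solid with no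
resolution INSIDE the moves (¬LU/¬C)). No landed Negative lemma concerns any stub.
[Kontsevich–Zagier 2001 §1.2; Ayoub 2015 Conj. 1.1; Hironaka 1964; Bierstone–Milman 1988 §4]
-/

noncomputable section

set_option linter.dupNamespace false

namespace Summit.KontsevichZagierPeriods.KontsevichZagierPeriods.Cruxes.VolumeFormOffPlane.ArithmeticResolution

open MeasureTheory Set
open Literature.ModelTheory.ExponentialFields (IsSemialgebraic)
open Literature.NumberTheory.Transcendental
open Literature.NumberTheory.Transcendental.KZ
open Summit.KontsevichZagierPeriods.KontsevichZagierPeriods (TypeAGenerationConjecture)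
open Summit.KontsevichZagierPeriods.KontsevichZagierPeriods.Theses.LiftingCriteria (CubeNashNormalForm)
open Summit.KontsevichZagierPeriods.KontsevichZagierPeriods.Theses.SymplecticScissors
  (VolumeFormOffPlane VolumeForm TypeAGeneration)
open Summit.KontsevichZagierPeriods.KontsevichZagierPeriods.StokesGenerationLine
  (sum_cubeNash_mem_relations_of_typeAGenerationConjecture)
open Summit.KontsevichZagierPeriods.LiftingCriteria.CubeNashNormalFormDimLeOne
  (cubeNashNormalForm_of_volume_three)

/-! ## Stubs -/

/-- **Stub (T) — the arithmetic input**: the route item `TypeAGeneration` (stmt-18392), i.e.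
Ayoub 2015 Conj. 1.1 / Fresán 2024 Conj. 3.5 (type-(a) generation of the kernel of `∫_{[0,1]^∞}` on
`𝒪_{k-alg}(𝔻̄^∞)`). OPEN, GPC-strength; printed. [cite: Ayoub2015, Conj. 1.1] -/
theorem stub_typeAGeneration : TypeAGeneration := by
  sorry

/-- **Stub (LU) — local uniformization of bounded `ℚ`-semialgebraic solids of dimension `≥ 3` by
cube charts** (no moves, no values): off a null set, `S` is the disjoint union of finitely many
images `Φⱼ '' (0,1)^{m+3}` with `Φⱼ` `ℚ`-semialgebraic and real-analytic on an open `Uⱼ ⊇ [0,1]^{m+3}`,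
injective on the open cube, `det DΦⱼ ≥ 0` on the closed cube. Embedded resolution of `∂S` over `ℝ`
(Hironaka) / rectilinearization of semialgebraic sets (Bierstone–Milman §4), chart by chart, with the
orientation of each chart fixed by a coordinate reflection. OPEN in the tree, XL.
[cite: BierstoneMilman1988, §4] [cite: Hironaka1964] -/
theorem stub_localUniformization :
    ∀ (m : ℕ) (S : Set (Fin (m + 3) → ℝ)), IsSemialgebraic ℚ S → Bornology.IsBounded S →
      ∃ (J : ℕ) (Φ : Fin J → (Fin (m + 3) → ℝ) → (Fin (m + 3) → ℝ))
        (U : Fin J → Set (Fin (m + 3) → ℝ)),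
        (∀ j, IsOpen (U j) ∧ Set.pi Set.univ (fun _ : Fin (m + 3) => Set.Icc (0:ℝ) 1) ⊆ U j ∧
          IsSemialgebraicMapOn ℚ (U j) (Φ j) ∧ AnalyticOnNhd ℝ (Φ j) (U j) ∧
          Set.InjOn (Φ j) (Set.pi Set.univ (fun _ : Fin (m + 3) => Set.Ioo (0:ℝ) 1)) ∧
          (∀ x ∈ Set.pi Set.univ (fun _ : Fin (m + 3) => Set.Icc (0:ℝ) 1),
            0 ≤ (fderiv ℝ (Φ j) x).det)) ∧
        (Pairwise fun i j => Disjoint (Φ i '' Set.pi Set.univ (fun _ : Fin (m + 3) => Set.Ioo (0:ℝ) 1))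
          (Φ j '' Set.pi Set.univ (fun _ : Fin (m + 3) => Set.Ioo (0:ℝ) 1))) ∧
        (∀ j, Φ j '' Set.pi Set.univ (fun _ : Fin (m + 3) => Set.Ioo (0:ℝ) 1) ⊆ S) ∧
        volume (S \ ⋃ j, Φ j '' Set.pi Set.univ (fun _ : Fin (m + 3) => Set.Ioo (0:ℝ) 1)) = 0 := by
  sorry

/-- **Stub (C) — the chart compiler** (provable now, M–L): cube charts for `K.domain` as in (LU)
give the cube–Nash normal form of `[K]` INSIDE THE MOVES — domain additivity over the disjoint
a.e. cover (null remainder, null cube boundary ≡ 0) and one change-of-variables move per chart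
(`KZ.changeOfVariablesRel`, `Φ' = fderiv ℝ Φⱼ`, new integrand `|det DΦⱼ| = det DΦⱼ`, which is
`ℚ`-semialgebraic and real-analytic on `Uⱼ`); the conclusion is verbatim the hypothesis of
`cubeNashNormalForm_of_volume_three` at `K`. [cite: KontsevichZagier2001, §1.2 rules (1), (2)] -/
theorem stub_chartsToNormalForm :
    ∀ (m : ℕ) (K : IntegralRep (m + 3)), (∀ x ∈ K.domain, K.integrand x = 1) →
      ∀ (J : ℕ) (Φ : Fin J → (Fin (m + 3) → ℝ) → (Fin (m + 3) → ℝ))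
        (U : Fin J → Set (Fin (m + 3) → ℝ)),
        (∀ j, IsOpen (U j) ∧ Set.pi Set.univ (fun _ : Fin (m + 3) => Set.Icc (0:ℝ) 1) ⊆ U j ∧
          IsSemialgebraicMapOn ℚ (U j) (Φ j) ∧ AnalyticOnNhd ℝ (Φ j) (U j) ∧
          Set.InjOn (Φ j) (Set.pi Set.univ (fun _ : Fin (m + 3) => Set.Ioo (0:ℝ) 1)) ∧
          (∀ x ∈ Set.pi Set.univ (fun _ : Fin (m + 3) => Set.Icc (0:ℝ) 1),
            0 ≤ (fderiv ℝ (Φ j) x).det)) →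
        (Pairwise fun i j => Disjoint (Φ i '' Set.pi Set.univ (fun _ : Fin (m + 3) => Set.Ioo (0:ℝ) 1))
          (Φ j '' Set.pi Set.univ (fun _ : Fin (m + 3) => Set.Ioo (0:ℝ) 1))) →
        (∀ j, Φ j '' Set.pi Set.univ (fun _ : Fin (m + 3) => Set.Ioo (0:ℝ) 1) ⊆ K.domain) →
        volume (K.domain \ ⋃ j, Φ j '' Set.pi Set.univ (fun _ : Fin (m + 3) => Set.Ioo (0:ℝ) 1)) = 0 →
      ∃ (S : ℕ) (n : Fin S → ℕ) (g : (i : Fin S) → (Fin (n i) → ℝ) → ℝ)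
        (U' : (i : Fin S) → Set (Fin (n i) → ℝ)) (ε : Fin S → ℤ) (s : (i : Fin S) → IntegralRep (n i)),
        (∀ i, IsOpen (U' i) ∧ Set.pi Set.univ (fun _ : Fin (n i) => Set.Icc (0:ℝ) 1) ⊆ (U' i) ∧
          IsSemialgebraicFunOn ℚ (U' i) (g i) ∧ AnalyticOnNhd ℝ (g i) (U' i)) ∧
        (∀ i, (s i).domain = Set.pi Set.univ (fun _ : Fin (n i) => Set.Icc (0:ℝ) 1) ∧
          ∀ z ∈ Set.pi Set.univ (fun _ : Fin (n i) => Set.Icc (0:ℝ) 1), (s i).integrand z = g i z) ∧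
        of K - ∑ i, ε i • of (s i) ∈ relations := by
  sorry

/-! ## Composition (sorry-free) -/

/-- (LU) + (C) ⇒ the cube–Nash normal form of bounded integrand-`1` solids of dimension `≥ 3`, hence
(landed reduction, plane and line discharged in the tree) the item `CubeNashNormalForm` (stmt-3574).
[cite: KontsevichZagier2001, §1.2] -/
theorem cubeNashNormalForm_of_stubs : CubeNashNormalForm := by
  refine cubeNashNormalForm_of_volume_three fun m K hKb hK1 => ?_
  obtain ⟨J, Φ, U, hch, hdisj, hsub, hnull⟩ :=
    stub_localUniformization m K.domain K.isSemialgebraic_domain hKb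
  exact stub_chartsToNormalForm m K hK1 J Φ U hch hdisj hsub hnull

/-- An integrand-`1` representation has KZ's literal shape. [folklore] -/
theorem isRational_of_integrand_one {N : ℕ} (r : IntegralRep N)
    (hr : ∀ x ∈ r.domain, r.integrand x = 1) : r.IsRational :=
  ⟨1, 1, fun x _ => by simp, fun x hx => by simp [hr x hx]⟩

/-- The glue of the decomposition, inline (= `OffPlaneSplit.volumeForm_of_subs` of the strategist's
`StrategistSplit.lean`, item stmt-18438): (T) ∧ `CubeNashNormalForm` ⇒ the frame in every dimension —
normal form inside the moves, value `0` by soundness, relation by the landed Ayoub compiler,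
telescope. [cite: KontsevichZagier2001, §1.2 Conjecture 1] -/
theorem volumeForm_of_typeA_of_cubeNash (hT : TypeAGenerationConjecture) (hN : CubeNashNormalForm) :
    VolumeForm := by
  classical
  intro N r r' hr hr' hv
  obtain ⟨S, nS, g, U, ε, s, hNash, hs, hNF⟩ :=
    hN N N r r' (isRational_of_integrand_one r hr) (isRational_of_integrand_one r' hr')
  have hsum0 : eval (∑ i, ε i • of (s i)) = 0 := by
    have h := relations_le_ker_eval_holds hNF
    rw [AddMonoidHom.mem_ker, map_sub, map_sub, eval_of, eval_of, hv, sub_self, zero_sub,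
      neg_eq_zero] at h
    exact h
  have hsum : ∑ i, ε i • of (s i) ∈ relations :=
    sum_cubeNash_mem_relations_of_typeAGenerationConjecture hT S nS g U ε s hNash hs hsum0
  show of r - of r' ∈ relations
  have e : of r - of r' = (of r - of r' - ∑ i, ε i • of (s i)) + ∑ i, ε i • of (s i) := by abel
  rw [e]
  exact relations.add_mem hNF hsum

/-- **The crux by name, modulo the three stubs.** [cite: KontsevichZagier2001, §1.2 Conjecture 1] -/
theorem VolumeFormOffPlane_of :
    Summit.KontsevichZagierPeriods.KontsevichZagierPeriods.Theses.SymplecticScissors.VolumeFormOffPlane :=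
  fun _ _ r r' hr hr' hv =>
    volumeForm_of_typeA_of_cubeNash stub_typeAGeneration cubeNashNormalForm_of_stubs r r' hr hr' hv

end Summit.KontsevichZagierPeriods.KontsevichZagierPeriods.Cruxes.VolumeFormOffPlane.ArithmeticResolution

end
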